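import Summits.CriticalPhenomena.CardyFormulaZ2.Theorems.CardyComplexConeEdgePrecompactUFRSJunctionFunnelScaled

/-!
# The junction funnel, part J: the frame of a physical junction
(line `qkz-strip-boundary-arm` of crux `CardyComplexCone.EdgePrecompact`, stmt-CriticalPhenomena-11387;
tenth file of the registered sub-goal S2 = `ufrs_junctionFunnel`, lead c5, wave 4; registered
anchor `frame_choice_JF`; pure `ℤ²` bookkeeping)

`frame_choice_JF` — for the lattice box `[i₀, i₁] × [j₀, j₁]`, a junction `{nA, nB}` of
lattice-adjacent boundary sites and thresholds `ν₀ ≪ Lf` such that every corner of the box is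
within sup-distance `ν₀` of `nA` or beyond `Lf`, a case analysis over the four sides, the four
corners and the two chiralities produces: a direction `kμ` (to be rotated to `+x₁` by the frame),
an origin `n` within `ν₀` of `nA`, a chirality `s = ±1` and flags `corner`, `onA` with a height
`t₀`, such that in the coordinates `n + a u_{kμ+3} + b u_{kμ}` the box near `n` is the
half-plane `b ≥ 0` (flat: `n = nA`, `nB = nA - s u_{kμ+3}`) or the quadrant `b ≥ 0, s a ≥ 0`
(corner: `n` the box corner, the junction on the leg `u_{kμ}` at height `t₀` with `nA` above
`nB`, or on the leg `s u_{kμ+3}` with `nB` beyond `nA`) — the physical input of `core_funnel_JF`.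

References: folklore.
-/

set_option linter.unusedVariables false

namespace Summit.CriticalPhenomena.CardyFormulaZ2.Cruxes.EdgePrecompact.QkzStripBoundaryArm

open MeasureTheory Filter Set Metric
open scoped Topology BigOperators Pointwise
open Literature.Probability.LatticeModels Literature.Probability.Percolation
open Literature.Probability.RandomPlanarGeometry (DobrushinDomain)
open Summit.CriticalPhenomena.CardyFormulaZ2.Theses.CardyComplexCone

noncomputable section


/-! ## The frame of a physical junction: four sides, four corners, two chiralities -/

/-- **Choice of the frame** (pure `ℤ²` bookkeeping). For the lattice box `[i₀, i₁] × [j₀, j₁]`, a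
junction `{nA, nB}` of lattice-adjacent boundary sites, and thresholds `ν₀` (near) `≪ Lf` (far)
such that every corner of the box is either within sup-distance `ν₀` of `nA` or beyond `Lf`:
there are a direction `kμ` (to be rotated to `+x₁`), an origin `n` within `ν₀` of `nA`, a
chirality `s = ±1`, and flags such that, in the coordinates `n + a u_{kμ+3} + b u_{kμ}`, the box
near `n` is the half-plane `b ≥ 0` (FLAT: `n = nA`, `nB = nA - s u_{kμ+3}`) or the quadrant
`b ≥ 0, s a ≥ 0` (CORNER: `n` the box corner, the junction on the leg `u_{kμ}` at height `t₀`
with `nA` above `nB` (`onA`), or on the leg `s u_{kμ+3}` at `s a = t₀` with `nB` beyond `nA`). -/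
theorem frame_choice_JF : ∀ (i₀ i₁ j₀ j₁ ν₀ Lf : ℤ) (nA nB : Site 2), 0 ≤ ν₀ → 2 * ν₀ + 6 ≤ Lf → Lf ≤ i₁ - i₀ → Lf ≤ j₁ - j₀ → ((i₀ ≤ nA 0 ∧ nA 0 ≤ i₁ ∧ j₀ ≤ nA 1 ∧ nA 1 ≤ j₁) ∧ (nA 0 = i₀ ∨ nA 0 = i₁ ∨ nA 1 = j₀ ∨ nA 1 = j₁)) → ((i₀ ≤ nB 0 ∧ nB 0 ≤ i₁ ∧ j₀ ≤ nB 1 ∧ nB 1 ≤ j₁) ∧ (nB 0 = i₀ ∨ nB 0 = i₁ ∨ nB 1 = j₀ ∨ nB 1 = j₁)) → (zdGraph 2).Adj nA nB → (∀ ic jc : ℤ, (ic = i₀ ∨ ic = i₁) → (jc = j₀ ∨ jc = j₁) → (|nA 0 - ic| ≤ ν₀ ∧ |nA 1 - jc| ≤ ν₀) ∨ (Lf ≤ |nA 0 - ic| ∨ Lf ≤ |nA 1 - jc|)) → ∃ (kμ : Fin 4) (n : Site 2) (s : ℤ) (corner onA : Bool) (t₀ : ℤ), (s = 1 ∨ s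 = -1) ∧ (|n 0 - nA 0| ≤ ν₀ ∧ |n 1 - nA 1| ≤ ν₀) ∧ (∀ a b : ℤ, -(Lf - ν₀ - 2) ≤ a → a ≤ Lf - ν₀ - 2 → -(Lf - ν₀ - 2) ≤ b → b ≤ Lf - ν₀ - 2 → ((i₀ ≤ n 0 + a * cornerUnit (kμ + 3) 0 + b * cornerUnit kμ 0 ∧ n 0 + a * cornerUnit (kμ + 3) 0 + b * cornerUnit kμ 0 ≤ i₁ ∧ j₀ ≤ n 1 + a * cornerUnit (kμ + 3) 1 + b * cornerUnit kμ 1 ∧ n 1 + a * cornerUnit (kμ + 3) 1 + b * cornerUnit kμ 1 ≤ j₁) ↔ (0 ≤ b ∧ (corner = true → 0 ≤ s * a)))) ∧ (corner = false → (nA 0 = n 0 ∧ nA 1 = n 1) ∧ (nB 0 = n 0 - s * cornerUnit (kμ + 3) 0 ∧ nB 1 = n 1 - s * cornerUnit (kμ + 3) 1)) ∧ (corner = true → 1 ≤ t₀ ∧ t₀ ≤ ν₀ + 1 ∧ (onA = true → (nA 0 = n 0 + t₀ * cornerUnit kμ 0 ∧ nA 1 = n 1 + t₀ * cornerUnit kμ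 1) ∧ (nB 0 = n 0 + (t₀ - 1) * cornerUnit kμ 0 ∧ nB 1 = n 1 + (t₀ - 1) * cornerUnit kμ 1)) ∧ (onA = false → (nB 0 = n 0 + s * t₀ * cornerUnit (kμ + 3) 0 ∧ nB 1 = n 1 + s * t₀ * cornerUnit (kμ + 3) 1) ∧ (nA 0 = n 0 + s * (t₀ - 1) * cornerUnit (kμ + 3) 0 ∧ nA 1 = n 1 + s * (t₀ - 1) * cornerUnit (kμ + 3) 1))) := by
  intro i₀ i₁ j₀ j₁ ν₀ Lf nA nB hν₀ hLf hW hH hnA hnB hadj hc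
  -- the `D4` table at the four directions
  have c0 : cornerUnit ((0 : Fin 4) + 3) 0 = 0 ∧ cornerUnit ((0 : Fin 4) + 3) 1 = -1 ∧ cornerUnit (0 : Fin 4) 0 = 1 ∧ cornerUnit (0 : Fin 4) 1 = 0 := by decide
  have c1 : cornerUnit ((1 : Fin 4) + 3) 0 = 1 ∧ cornerUnit ((1 : Fin 4) + 3) 1 = 0 ∧ cornerUnit (1 : Fin 4) 0 = 0 ∧ cornerUnit (1 : Fin 4) 1 = 1 := by decide
  have c2 : cornerUnit ((2 : Fin 4) + 3) 0 = 0 ∧ cornerUnit ((2 : Fin 4) + 3) 1 = 1 ∧ cornerUnit (2 : Fin 4) 0 = -1 ∧ cornerUnit (2 : Fin 4) 1 = 0 := by decide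
  have c3 : cornerUnit ((3 : Fin 4) + 3) 0 = -1 ∧ cornerUnit ((3 : Fin 4) + 3) 1 = 0 ∧ cornerUnit (3 : Fin 4) 0 = 0 ∧ cornerUnit (3 : Fin 4) 1 = -1 := by decide
  rw [adj_iff_coord_JF] at hadj
  have hSW := hc i₀ j₀ (Or.inl rfl) (Or.inl rfl)
  have hSE := hc i₁ j₀ (Or.inr rfl) (Or.inl rfl)
  have hNW := hc i₀ j₁ (Or.inl rfl) (Or.inr rfl)
  have hNE := hc i₁ j₁ (Or.inr rfl) (Or.inr rfl)
  simp only [abs_le, le_abs] at hSW hSE hNW hNE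
  by_cases hSWc : (-ν₀ ≤ nA 0 - i₀ ∧ nA 0 - i₀ ≤ ν₀) ∧ (-ν₀ ≤ nA 1 - j₀ ∧ nA 1 - j₀ ≤ ν₀)
  · -- corner SW
    clear hSE hNW hNE
    by_cases hrow : nA 1 = j₀ ∧ nB 1 = j₀
    · rcases (show nB 0 = nA 0 + 1 ∨ nA 0 = nB 0 + 1 by omega) with hB | hB
      · refine ⟨1, ![i₀, j₀], 1, true, false, nB 0 - i₀, by norm_num, ?_, ?_, ?_, ?_⟩
        · simp only [Matrix.cons_val_zero, Matrix.cons_val_one, abs_le]; omega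
        · intro a b ha1 ha2 hb1 hb2
          simp only [Matrix.cons_val_zero, Matrix.cons_val_one]
          rw [c1.1, c1.2.1, c1.2.2.1, c1.2.2.2]
          exact ⟨fun ⟨h1, h2, h3, h4⟩ => ⟨by omega, fun _ => by omega⟩, fun ⟨h1, h2⟩ => by have h3 := h2 (by decide); omega⟩
        · intro h; exact absurd h (by decide)
        · intro _
          simp only [Matrix.cons_val_zero, Matrix.cons_val_one]
          rw [c1.1, c1.2.1, c1.2.2.1, c1.2.2.2]
          exact ⟨by omega, by omega, fun h => absurd h (by decide), fun _ => ⟨⟨by omega, by omega⟩, ⟨by omega, by omega⟩⟩⟩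
      · refine ⟨0, ![i₀, j₀], -1, true, true, nA 0 - i₀, by norm_num, ?_, ?_, ?_, ?_⟩
        · simp only [Matrix.cons_val_zero, Matrix.cons_val_one, abs_le]; omega
        · intro a b ha1 ha2 hb1 hb2
          simp only [Matrix.cons_val_zero, Matrix.cons_val_one]
          rw [c0.1, c0.2.1, c0.2.2.1, c0.2.2.2]
          exact ⟨fun ⟨h1, h2, h3, h4⟩ => ⟨by omega, fun _ => by omega⟩, fun ⟨h1, h2⟩ => by have h3 := h2 (by decide); omega⟩
        · intro h; exact absurd h (by decide)
        · intro _
          simp only [Matrix.cons_val_zero, Matrix.cons_val_one]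
          rw [c0.1, c0.2.1, c0.2.2.1, c0.2.2.2]
          exact ⟨by omega, by omega, fun _ => ⟨⟨by omega, by omega⟩, ⟨by omega, by omega⟩⟩, fun h => absurd h (by decide)⟩
    · by_cases hcol : nA 0 = i₀ ∧ nB 0 = i₀
      · rcases (show nB 1 = nA 1 + 1 ∨ nA 1 = nB 1 + 1 by omega) with hB | hB
        · refine ⟨0, ![i₀, j₀], -1, true, false, nB 1 - j₀, by norm_num, ?_, ?_, ?_, ?_⟩
          · simp only [Matrix.cons_val_zero, Matrix.cons_val_one, abs_le]; omega
          · intro a b ha1 ha2 hb1 hb2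
            simp only [Matrix.cons_val_zero, Matrix.cons_val_one]
            rw [c0.1, c0.2.1, c0.2.2.1, c0.2.2.2]
            exact ⟨fun ⟨h1, h2, h3, h4⟩ => ⟨by omega, fun _ => by omega⟩, fun ⟨h1, h2⟩ => by have h3 := h2 (by decide); omega⟩
          · intro h; exact absurd h (by decide)
          · intro _
            simp only [Matrix.cons_val_zero, Matrix.cons_val_one]
            rw [c0.1, c0.2.1, c0.2.2.1, c0.2.2.2]
            exact ⟨by omega, by omega, fun h => absurd h (by decide), fun _ => ⟨⟨by omega, by omega⟩, ⟨by omega, by omega⟩⟩⟩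
        · refine ⟨1, ![i₀, j₀], 1, true, true, nA 1 - j₀, by norm_num, ?_, ?_, ?_, ?_⟩
          · simp only [Matrix.cons_val_zero, Matrix.cons_val_one, abs_le]; omega
          · intro a b ha1 ha2 hb1 hb2
            simp only [Matrix.cons_val_zero, Matrix.cons_val_one]
            rw [c1.1, c1.2.1, c1.2.2.1, c1.2.2.2]
            exact ⟨fun ⟨h1, h2, h3, h4⟩ => ⟨by omega, fun _ => by omega⟩, fun ⟨h1, h2⟩ => by have h3 := h2 (by decide); omega⟩
          · intro h; exact absurd h (by decide)
          · intro _
            simp only [Matrix.cons_val_zero, Matrix.cons_val_one]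
            rw [c1.1, c1.2.1, c1.2.2.1, c1.2.2.2]
            exact ⟨by omega, by omega, fun _ => ⟨⟨by omega, by omega⟩, ⟨by omega, by omega⟩⟩, fun h => absurd h (by decide)⟩
      · exfalso; omega
  by_cases hSEc : (-ν₀ ≤ nA 0 - i₁ ∧ nA 0 - i₁ ≤ ν₀) ∧ (-ν₀ ≤ nA 1 - j₀ ∧ nA 1 - j₀ ≤ ν₀)
  · -- corner SE
    clear hSW hNW hNE hSWc
    by_cases hrow : nA 1 = j₀ ∧ nB 1 = j₀
    · rcases (show nB 0 = nA 0 + 1 ∨ nA 0 = nB 0 + 1 by omega) with hB | hB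
      · refine ⟨2, ![i₁, j₀], 1, true, true, i₁ - nA 0, by norm_num, ?_, ?_, ?_, ?_⟩
        · simp only [Matrix.cons_val_zero, Matrix.cons_val_one, abs_le]; omega
        · intro a b ha1 ha2 hb1 hb2
          simp only [Matrix.cons_val_zero, Matrix.cons_val_one]
          rw [c2.1, c2.2.1, c2.2.2.1, c2.2.2.2]
          exact ⟨fun ⟨h1, h2, h3, h4⟩ => ⟨by omega, fun _ => by omega⟩, fun ⟨h1, h2⟩ => by have h3 := h2 (by decide); omega⟩
        · intro h; exact absurd h (by decide)
        · intro _
          simp only [Matrix.cons_val_zero, Matrix.cons_val_one]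
          rw [c2.1, c2.2.1, c2.2.2.1, c2.2.2.2]
          exact ⟨by omega, by omega, fun _ => ⟨⟨by omega, by omega⟩, ⟨by omega, by omega⟩⟩, fun h => absurd h (by decide)⟩
      · refine ⟨1, ![i₁, j₀], -1, true, false, i₁ - nB 0, by norm_num, ?_, ?_, ?_, ?_⟩
        · simp only [Matrix.cons_val_zero, Matrix.cons_val_one, abs_le]; omega
        · intro a b ha1 ha2 hb1 hb2
          simp only [Matrix.cons_val_zero, Matrix.cons_val_one]
          rw [c1.1, c1.2.1, c1.2.2.1, c1.2.2.2]
          exact ⟨fun ⟨h1, h2, h3, h4⟩ => ⟨by omega, fun _ => by omega⟩, fun ⟨h1, h2⟩ => by have h3 := h2 (by decide); omega⟩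
        · intro h; exact absurd h (by decide)
        · intro _
          simp only [Matrix.cons_val_zero, Matrix.cons_val_one]
          rw [c1.1, c1.2.1, c1.2.2.1, c1.2.2.2]
          exact ⟨by omega, by omega, fun h => absurd h (by decide), fun _ => ⟨⟨by omega, by omega⟩, ⟨by omega, by omega⟩⟩⟩
    · by_cases hcol : nA 0 = i₁ ∧ nB 0 = i₁
      · rcases (show nB 1 = nA 1 + 1 ∨ nA 1 = nB 1 + 1 by omega) with hB | hB
        · refine ⟨2, ![i₁, j₀], 1, true, false, nB 1 - j₀, by norm_num, ?_, ?_, ?_, ?_⟩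
          · simp only [Matrix.cons_val_zero, Matrix.cons_val_one, abs_le]; omega
          · intro a b ha1 ha2 hb1 hb2
            simp only [Matrix.cons_val_zero, Matrix.cons_val_one]
            rw [c2.1, c2.2.1, c2.2.2.1, c2.2.2.2]
            exact ⟨fun ⟨h1, h2, h3, h4⟩ => ⟨by omega, fun _ => by omega⟩, fun ⟨h1, h2⟩ => by have h3 := h2 (by decide); omega⟩
          · intro h; exact absurd h (by decide)
          · intro _
            simp only [Matrix.cons_val_zero, Matrix.cons_val_one]
            rw [c2.1, c2.2.1, c2.2.2.1, c2.2.2.2]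
            exact ⟨by omega, by omega, fun h => absurd h (by decide), fun _ => ⟨⟨by omega, by omega⟩, ⟨by omega, by omega⟩⟩⟩
        · refine ⟨1, ![i₁, j₀], -1, true, true, nA 1 - j₀, by norm_num, ?_, ?_, ?_, ?_⟩
          · simp only [Matrix.cons_val_zero, Matrix.cons_val_one, abs_le]; omega
          · intro a b ha1 ha2 hb1 hb2
            simp only [Matrix.cons_val_zero, Matrix.cons_val_one]
            rw [c1.1, c1.2.1, c1.2.2.1, c1.2.2.2]
            exact ⟨fun ⟨h1, h2, h3, h4⟩ => ⟨by omega, fun _ => by omega⟩, fun ⟨h1, h2⟩ => by have h3 := h2 (by decide); omega⟩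
          · intro h; exact absurd h (by decide)
          · intro _
            simp only [Matrix.cons_val_zero, Matrix.cons_val_one]
            rw [c1.1, c1.2.1, c1.2.2.1, c1.2.2.2]
            exact ⟨by omega, by omega, fun _ => ⟨⟨by omega, by omega⟩, ⟨by omega, by omega⟩⟩, fun h => absurd h (by decide)⟩
      · exfalso; omega
  by_cases hNWc : (-ν₀ ≤ nA 0 - i₀ ∧ nA 0 - i₀ ≤ ν₀) ∧ (-ν₀ ≤ nA 1 - j₁ ∧ nA 1 - j₁ ≤ ν₀)
  · -- corner NW
    clear hSW hSE hNE hSWc hSEc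
    by_cases hrow : nA 1 = j₁ ∧ nB 1 = j₁
    · rcases (show nB 0 = nA 0 + 1 ∨ nA 0 = nB 0 + 1 by omega) with hB | hB
      · refine ⟨3, ![i₀, j₁], -1, true, false, nB 0 - i₀, by norm_num, ?_, ?_, ?_, ?_⟩
        · simp only [Matrix.cons_val_zero, Matrix.cons_val_one, abs_le]; omega
        · intro a b ha1 ha2 hb1 hb2
          simp only [Matrix.cons_val_zero, Matrix.cons_val_one]
          rw [c3.1, c3.2.1, c3.2.2.1, c3.2.2.2]
          exact ⟨fun ⟨h1, h2, h3, h4⟩ => ⟨by omega, fun _ => by omega⟩, fun ⟨h1, h2⟩ => by have h3 := h2 (by decide); omega⟩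
        · intro h; exact absurd h (by decide)
        · intro _
          simp only [Matrix.cons_val_zero, Matrix.cons_val_one]
          rw [c3.1, c3.2.1, c3.2.2.1, c3.2.2.2]
          exact ⟨by omega, by omega, fun h => absurd h (by decide), fun _ => ⟨⟨by omega, by omega⟩, ⟨by omega, by omega⟩⟩⟩
      · refine ⟨0, ![i₀, j₁], 1, true, true, nA 0 - i₀, by norm_num, ?_, ?_, ?_, ?_⟩
        · simp only [Matrix.cons_val_zero, Matrix.cons_val_one, abs_le]; omega
        · intro a b ha1 ha2 hb1 hb2
          simp only [Matrix.cons_val_zero, Matrix.cons_val_one]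
          rw [c0.1, c0.2.1, c0.2.2.1, c0.2.2.2]
          exact ⟨fun ⟨h1, h2, h3, h4⟩ => ⟨by omega, fun _ => by omega⟩, fun ⟨h1, h2⟩ => by have h3 := h2 (by decide); omega⟩
        · intro h; exact absurd h (by decide)
        · intro _
          simp only [Matrix.cons_val_zero, Matrix.cons_val_one]
          rw [c0.1, c0.2.1, c0.2.2.1, c0.2.2.2]
          exact ⟨by omega, by omega, fun _ => ⟨⟨by omega, by omega⟩, ⟨by omega, by omega⟩⟩, fun h => absurd h (by decide)⟩
    · by_cases hcol : nA 0 = i₀ ∧ nB 0 = i₀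
      · rcases (show nB 1 = nA 1 + 1 ∨ nA 1 = nB 1 + 1 by omega) with hB | hB
        · refine ⟨3, ![i₀, j₁], -1, true, true, j₁ - nA 1, by norm_num, ?_, ?_, ?_, ?_⟩
          · simp only [Matrix.cons_val_zero, Matrix.cons_val_one, abs_le]; omega
          · intro a b ha1 ha2 hb1 hb2
            simp only [Matrix.cons_val_zero, Matrix.cons_val_one]
            rw [c3.1, c3.2.1, c3.2.2.1, c3.2.2.2]
            exact ⟨fun ⟨h1, h2, h3, h4⟩ => ⟨by omega, fun _ => by omega⟩, fun ⟨h1, h2⟩ => by have h3 := h2 (by decide); omega⟩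
          · intro h; exact absurd h (by decide)
          · intro _
            simp only [Matrix.cons_val_zero, Matrix.cons_val_one]
            rw [c3.1, c3.2.1, c3.2.2.1, c3.2.2.2]
            exact ⟨by omega, by omega, fun _ => ⟨⟨by omega, by omega⟩, ⟨by omega, by omega⟩⟩, fun h => absurd h (by decide)⟩
        · refine ⟨0, ![i₀, j₁], 1, true, false, j₁ - nB 1, by norm_num, ?_, ?_, ?_, ?_⟩
          · simp only [Matrix.cons_val_zero, Matrix.cons_val_one, abs_le]; omega
          · intro a b ha1 ha2 hb1 hb2
            simp only [Matrix.cons_val_zero, Matrix.cons_val_one]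
            rw [c0.1, c0.2.1, c0.2.2.1, c0.2.2.2]
            exact ⟨fun ⟨h1, h2, h3, h4⟩ => ⟨by omega, fun _ => by omega⟩, fun ⟨h1, h2⟩ => by have h3 := h2 (by decide); omega⟩
          · intro h; exact absurd h (by decide)
          · intro _
            simp only [Matrix.cons_val_zero, Matrix.cons_val_one]
            rw [c0.1, c0.2.1, c0.2.2.1, c0.2.2.2]
            exact ⟨by omega, by omega, fun h => absurd h (by decide), fun _ => ⟨⟨by omega, by omega⟩, ⟨by omega, by omega⟩⟩⟩
      · exfalso; omega
  by_cases hNEc : (-ν₀ ≤ nA 0 - i₁ ∧ nA 0 - i₁ ≤ ν₀) ∧ (-ν₀ ≤ nA 1 - j₁ ∧ nA 1 - j₁ ≤ ν₀)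
  · -- corner NE
    clear hSW hSE hNW hSWc hSEc hNWc
    by_cases hrow : nA 1 = j₁ ∧ nB 1 = j₁
    · rcases (show nB 0 = nA 0 + 1 ∨ nA 0 = nB 0 + 1 by omega) with hB | hB
      · refine ⟨2, ![i₁, j₁], -1, true, true, i₁ - nA 0, by norm_num, ?_, ?_, ?_, ?_⟩
        · simp only [Matrix.cons_val_zero, Matrix.cons_val_one, abs_le]; omega
        · intro a b ha1 ha2 hb1 hb2
          simp only [Matrix.cons_val_zero, Matrix.cons_val_one]
          rw [c2.1, c2.2.1, c2.2.2.1, c2.2.2.2]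
          exact ⟨fun ⟨h1, h2, h3, h4⟩ => ⟨by omega, fun _ => by omega⟩, fun ⟨h1, h2⟩ => by have h3 := h2 (by decide); omega⟩
        · intro h; exact absurd h (by decide)
        · intro _
          simp only [Matrix.cons_val_zero, Matrix.cons_val_one]
          rw [c2.1, c2.2.1, c2.2.2.1, c2.2.2.2]
          exact ⟨by omega, by omega, fun _ => ⟨⟨by omega, by omega⟩, ⟨by omega, by omega⟩⟩, fun h => absurd h (by decide)⟩
      · refine ⟨3, ![i₁, j₁], 1, true, false, i₁ - nB 0, by norm_num, ?_, ?_, ?_, ?_⟩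
        · simp only [Matrix.cons_val_zero, Matrix.cons_val_one, abs_le]; omega
        · intro a b ha1 ha2 hb1 hb2
          simp only [Matrix.cons_val_zero, Matrix.cons_val_one]
          rw [c3.1, c3.2.1, c3.2.2.1, c3.2.2.2]
          exact ⟨fun ⟨h1, h2, h3, h4⟩ => ⟨by omega, fun _ => by omega⟩, fun ⟨h1, h2⟩ => by have h3 := h2 (by decide); omega⟩
        · intro h; exact absurd h (by decide)
        · intro _
          simp only [Matrix.cons_val_zero, Matrix.cons_val_one]
          rw [c3.1, c3.2.1, c3.2.2.1, c3.2.2.2]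
          exact ⟨by omega, by omega, fun h => absurd h (by decide), fun _ => ⟨⟨by omega, by omega⟩, ⟨by omega, by omega⟩⟩⟩
    · by_cases hcol : nA 0 = i₁ ∧ nB 0 = i₁
      · rcases (show nB 1 = nA 1 + 1 ∨ nA 1 = nB 1 + 1 by omega) with hB | hB
        · refine ⟨3, ![i₁, j₁], 1, true, true, j₁ - nA 1, by norm_num, ?_, ?_, ?_, ?_⟩
          · simp only [Matrix.cons_val_zero, Matrix.cons_val_one, abs_le]; omega
          · intro a b ha1 ha2 hb1 hb2
            simp only [Matrix.cons_val_zero, Matrix.cons_val_one]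
            rw [c3.1, c3.2.1, c3.2.2.1, c3.2.2.2]
            exact ⟨fun ⟨h1, h2, h3, h4⟩ => ⟨by omega, fun _ => by omega⟩, fun ⟨h1, h2⟩ => by have h3 := h2 (by decide); omega⟩
          · intro h; exact absurd h (by decide)
          · intro _
            simp only [Matrix.cons_val_zero, Matrix.cons_val_one]
            rw [c3.1, c3.2.1, c3.2.2.1, c3.2.2.2]
            exact ⟨by omega, by omega, fun _ => ⟨⟨by omega, by omega⟩, ⟨by omega, by omega⟩⟩, fun h => absurd h (by decide)⟩
        · refine ⟨2, ![i₁, j₁], -1, true, false, j₁ - nB 1, by norm_num, ?_, ?_, ?_, ?_⟩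
          · simp only [Matrix.cons_val_zero, Matrix.cons_val_one, abs_le]; omega
          · intro a b ha1 ha2 hb1 hb2
            simp only [Matrix.cons_val_zero, Matrix.cons_val_one]
            rw [c2.1, c2.2.1, c2.2.2.1, c2.2.2.2]
            exact ⟨fun ⟨h1, h2, h3, h4⟩ => ⟨by omega, fun _ => by omega⟩, fun ⟨h1, h2⟩ => by have h3 := h2 (by decide); omega⟩
          · intro h; exact absurd h (by decide)
          · intro _
            simp only [Matrix.cons_val_zero, Matrix.cons_val_one]
            rw [c2.1, c2.2.1, c2.2.2.1, c2.2.2.2]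
            exact ⟨by omega, by omega, fun h => absurd h (by decide), fun _ => ⟨⟨by omega, by omega⟩, ⟨by omega, by omega⟩⟩⟩
      · exfalso; omega
  -- flat: all four corners are far
  rcases hnA.2 with hside | hside | hside | hside
  · -- left side
    have f1 : Lf ≤ nA 1 - j₀ := by clear hSE hNE hSEc hNEc hNW hNWc; omega
    have f2 : Lf ≤ j₁ - nA 1 := by clear hSE hNE hSEc hNEc hSW hSWc; omega
    clear hSW hSE hNW hNE hSWc hSEc hNWc hNEc
    have hs : nB 1 - nA 1 = 1 ∨ nB 1 - nA 1 = -1 := by omega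
    refine ⟨0, ![nA 0, nA 1], nB 1 - nA 1, false, false, 0, hs, ?_, ?_, ?_, ?_⟩
    · simp only [Matrix.cons_val_zero, Matrix.cons_val_one, abs_le]; omega
    · intro a b ha1 ha2 hb1 hb2
      simp only [Matrix.cons_val_zero, Matrix.cons_val_one]
      rw [c0.1, c0.2.1, c0.2.2.1, c0.2.2.2]
      exact ⟨fun ⟨h1, h2, h3, h4⟩ => ⟨by omega, fun h => absurd h (by decide)⟩, fun ⟨h1, _⟩ => by omega⟩
    · intro _
      simp only [Matrix.cons_val_zero, Matrix.cons_val_one]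
      rw [c0.1, c0.2.1]
      exact ⟨⟨trivial, trivial⟩, ⟨by omega, by omega⟩⟩
    · intro h; exact absurd h (by decide)
  · -- right side
    have f1 : Lf ≤ nA 1 - j₀ := by clear hSW hNW hSWc hNWc hNE hNEc; omega
    have f2 : Lf ≤ j₁ - nA 1 := by clear hSW hNW hSWc hNWc hSE hSEc; omega
    clear hSW hSE hNW hNE hSWc hSEc hNWc hNEc
    have hs : nA 1 - nB 1 = 1 ∨ nA 1 - nB 1 = -1 := by omega
    refine ⟨2, ![nA 0, nA 1], nA 1 - nB 1, false, false, 0, hs, ?_, ?_, ?_, ?_⟩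
    · simp only [Matrix.cons_val_zero, Matrix.cons_val_one, abs_le]; omega
    · intro a b ha1 ha2 hb1 hb2
      simp only [Matrix.cons_val_zero, Matrix.cons_val_one]
      rw [c2.1, c2.2.1, c2.2.2.1, c2.2.2.2]
      exact ⟨fun ⟨h1, h2, h3, h4⟩ => ⟨by omega, fun h => absurd h (by decide)⟩, fun ⟨h1, _⟩ => by omega⟩
    · intro _
      simp only [Matrix.cons_val_zero, Matrix.cons_val_one]
      rw [c2.1, c2.2.1]
      exact ⟨⟨trivial, trivial⟩, ⟨by omega, by omega⟩⟩
    · intro h; exact absurd h (by decide)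
  · -- bottom side
    have f1 : Lf ≤ nA 0 - i₀ := by clear hNW hNE hNWc hNEc hSE hSEc; omega
    have f2 : Lf ≤ i₁ - nA 0 := by clear hNW hNE hNWc hNEc hSW hSWc; omega
    clear hSW hSE hNW hNE hSWc hSEc hNWc hNEc
    have hs : nA 0 - nB 0 = 1 ∨ nA 0 - nB 0 = -1 := by omega
    refine ⟨1, ![nA 0, nA 1], nA 0 - nB 0, false, false, 0, hs, ?_, ?_, ?_, ?_⟩
    · simp only [Matrix.cons_val_zero, Matrix.cons_val_one, abs_le]; omega
    · intro a b ha1 ha2 hb1 hb2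
      simp only [Matrix.cons_val_zero, Matrix.cons_val_one]
      rw [c1.1, c1.2.1, c1.2.2.1, c1.2.2.2]
      exact ⟨fun ⟨h1, h2, h3, h4⟩ => ⟨by omega, fun h => absurd h (by decide)⟩, fun ⟨h1, _⟩ => by omega⟩
    · intro _
      simp only [Matrix.cons_val_zero, Matrix.cons_val_one]
      rw [c1.1, c1.2.1]
      exact ⟨⟨trivial, trivial⟩, ⟨by omega, by omega⟩⟩
    · intro h; exact absurd h (by decide)
  · -- top side
    have f1 : Lf ≤ nA 0 - i₀ := by clear hSW hSE hSWc hSEc hNE hNEc; omega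
    have f2 : Lf ≤ i₁ - nA 0 := by clear hSW hSE hSWc hSEc hNW hNWc; omega
    clear hSW hSE hNW hNE hSWc hSEc hNWc hNEc
    have hs : nB 0 - nA 0 = 1 ∨ nB 0 - nA 0 = -1 := by omega
    refine ⟨3, ![nA 0, nA 1], nB 0 - nA 0, false, false, 0, hs, ?_, ?_, ?_, ?_⟩
    · simp only [Matrix.cons_val_zero, Matrix.cons_val_one, abs_le]; omega
    · intro a b ha1 ha2 hb1 hb2
      simp only [Matrix.cons_val_zero, Matrix.cons_val_one]
      rw [c3.1, c3.2.1, c3.2.2.1, c3.2.2.2]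
      exact ⟨fun ⟨h1, h2, h3, h4⟩ => ⟨by omega, fun h => absurd h (by decide)⟩, fun ⟨h1, _⟩ => by omega⟩
    · intro _
      simp only [Matrix.cons_val_zero, Matrix.cons_val_one]
      rw [c3.1, c3.2.1]
      exact ⟨⟨trivial, trivial⟩, ⟨by omega, by omega⟩⟩
    · intro h; exact absurd h (by decide)

end

end Summit.CriticalPhenomena.CardyFormulaZ2.Cruxes.EdgePrecompact.QkzStripBoundaryArm
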